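import Mathlib
import HarnessLib
import Summits.Langlands.Langlands.Theses.ExteriorSquareAscent

/-!
# Disproof of `SelfTwistedIrreducible` (crux stmt-Langlands-18055) — findings: NO KILL (cycle 1)

Crux (`Summit.Langlands.Langlands.Theses.ExteriorSquareAscent.SelfTwistedIrreducible`, rank 4 of
route `route-Langlands-ExteriorSquareAscent`): for every number field `K`, every CUSPIDAL `π` on
`GL₄(𝔸_K)` that is C-algebraic, has a Hecke field (C-normalised Hecke eigenvalues
`q_v^{i(4-i)/2} e_i(t_{π,v})` in a number field `E`) and is self-twisted by the quadratic sign of some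
quadratic `L'/K` at a.e. place, and every `ℓ, ι`, every SEMISIMPLE `ρ : Γ_K → GL₄(ℚ̄_ℓ)` that is
unramified and Satake–Frobenius compatible with `(π, ι)` at a.e. place (`arithFrobPolyOfSatake ι q_v 4`)
is irreducible.

## Verdict of this cycle: the crux RESISTS, and for a structural reason no in-tree witness can exist

* (F1) ELABORATION. The crux elaborates (probe `W.lean` rc 0, one sorry); read back symbol by symbol:
  `Ideal.inertiaDeg : Ideal S → (R : Type) → … → ℕ` so the sign is `+1` at split AND ramified `v`
  (a degree-one prime above), `-1` at inert `v` — ramified places are finitely many, absorbed by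
  `cofinite`; `arithFrobPolyOfSatake` takes INVERSES `ι⁻¹((q^{3/2} a)⁻¹)` (arithmetic Frobenius), which
  is irrelevant for irreducibility; `i * (4 - i)` is exact for `i ≤ 4`; `IsIrreducible` is Mathlib's
  `IsSimpleOrder (Subrepresentation _)` (fine at `n = 4`); `IsSemisimple` is
  `Representation.IsSemisimpleRepresentation`. No junk operator bites. `crux_iff` below is `Iff.rfl`.
* (F2) NO LEAN WITNESS IS POSSIBLE FOR `¬ crux` OR FOR `¬` OF ANY HYPOTHESIS-DROPPED VARIANT: every
  variant keeps the binder `(π : CuspidalAutomorphicRepData 4 K hcpt)` (or at least an automorphic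
  datum) together with `HasSatakeParamAt` at cofinitely many places (forced by the compatibility clause:
  with no Satake parameters the clause `∀ᶠ v, ∃ α, HasSatakeParamAt v α ∧ …` is FALSE, making the
  instance vacuously TRUE, not false). The tree constructs automorphic forms on `GL_n`, `n ≥ 1`, only in
  the abelian family `affLogDet` (`χ ∘ det`, `log |det|`; cf. the `n = 0` refutation
  `OrdinaryPrimeTransportRankinSelbergPoleCountRefutation`), and § 2 PROVES that rank-one Satake data
  `c · {q^{-3/2}, q^{-1/2}, q^{1/2}, q^{3/2}}` NEVER satisfy the self-twist clause at an inert place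
  (`rankOne_satake_not_selfTwisted`: a negation-stable multiset is traceless, this one has trace
  `c · (positive real) ≠ 0`). A genuine witness needs an Eisenstein series or a cusp form on `GL₄(𝔸_K)` as
  an `IsAutomorphicForm` — not constructible here. Hence ALL load-bearing analysis below is ON PAPER
  (docstrings), and no `Negative/` lemma with an honest witness exists this cycle.
* (F3) ON PAPER THE CRUX IS IMPLIED BY STANDARD RECIPROCITY AND IS VERY LIKELY A THEOREM. Compatibility +
  Chebotarev + Brauer–Nesbitt give `ρ ≅ ρ ⊗ ε_{L'/K}`; Clifford leaves shapes (A) `ρ|_{Γ_L'}` = four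
  characters, (B) `ρ|_{Γ_L'} ≅ W ⊕ W`. (A) dies by Waldschmidt/Böckle–Hui rank one (PROVED in tree:
  `exists_heckeCharacter_of_weaklyDivides_holds`) + `GL₂ × GL₁` entireness vs the pole of `ζ_L'`. (B):
  if `f` (with `π = AI(f)`) had an attached Galois representation `σ_f`, then `σ_f ⊕ σ_f^γ ≅ W ⊕ W`
  (BN) forces `f ≅ f^γ`, contradicting cuspidality of `π`; so ANY counterexample to the crux is a
  cuspidal `f` on `GL₂/L'` violating GL₂-reciprocity — none is known or expected. Galois-free, (B) dies
  by the picked line `det-pinning` (PICKED.md 2026-08-17): `ν := (det W)^{Hecke} · ω_f⁻¹ · ‖·‖⁻³` is `1`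
  on good conjugate pairs and `≠ 1` on bad (= scalar) pairs, so Hecke non-vanishing gives lower
  Dirichlet density `≥ 1/2` for the bad set while positivity of `log L(σ, f × f̄)` (NO Ramanujan bound:
  prime-power terms are `|tr t^k|²/k ≥ 0`) caps the scalar set at `1/4` (`|a_f(w)|² = 4` there since
  `|x|² = |ω_f(w)| = 1` after unitary normalisation). I re-derived this adversarially (§ 4): no gap found.
* (F4) LOAD-BEARING HYPOTHESES (paper): CUSPIDAL — load-bearing (Eisenstein `‖·‖^{1/2}(1 ⊞ ε ⊞ 1 ⊞ ε)`
  over `ℚ` with `ρ = χ_cyc⁻¹ ⊗ (1 ⊕ ε ⊕ 1 ⊕ ε)` kills `WithoutCuspidal`; and the Artin family `V ⊕ V ⊗ ε`,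
  `V|_{Γ_L}` irreducible, e.g. `Gal = S₃ × C₂`, is exactly shape (B) with `f ≅ f^γ`, i.e. `AI(f)`
  isobaric non-cuspidal); COMPATIBILITY — load-bearing (`ρ = 1^{⊕4}`); HECKE FIELD — load-bearing for
  the PROOF (E-rationality feeds Böckle–Hui in (A) and `det W` Hecke in (B)), conjecturally automatic
  (Clozel/Buzzard–Gee: C-algebraic ⇒ C-arithmetic); SELF-TWIST — load-bearing for PROVABILITY only
  (dropping it gives cuspidal ⇒ irreducible for GL₄, believed true, open; it is the route's target X);
  `IsCAlgebraic` — NOT load-bearing on the picked line (used only by birth's dihedral Weil-avatar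
  branch); `IsSemisimple` — logically REDUNDANT (apply the crux to `ρ^{ss}`, which stays compatible and
  unramified; an irreducible semisimplification forces `ρ = ρ^{ss}`).
* (F5) NATURAL STRENGTHENINGS refuted by small models (§ 3, kernel-checked): the route's printed proof
  line bounds the scalar-Satake set by `1/9` via `L(s, Ad f × Ad f)`; the faithful `2`-dimensional
  representation of the dihedral group of order `8` has scalar locus of proportion `1/4 > 1/8 > 1/9`
  (`d4Rep_scalar_card`, `d4_card`), so that bound is FALSE for dihedral `f` (weight-one `D₄`-forms, by
  Chebotarev) — the `1/9`-method cannot drop its dihedral case split (hence needs `IsCAlgebraic` for the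
  Weil avatar); the picked det-pinning line is immune (its cap is `1/4`, its floor `1/2`). Ramakrishnan's
  `1/8` itself is sharp (`Q₈ × C₂`: two irreducible 2-dimensional representations agreeing on `7/8` of
  the group), so birth's margin `1/9 < 1/8` cannot be relaxed to `≤ 1/8`.
* (F6) TARGETS: none this cycle (payload `targets = []`, `stuck_stubs = []`; line `Sketch` = det-pinning
  picked at 11:42Z, stubs not yet registered). § 4 records the four soft spots of det-pinning I probed.

Literature / negatives consulted: route header + VETTING.md (rattack, survives), birth.md, PICKED.md,
the three crux ideas; `ledger negatives --problem Langlands` (4 entries: n = 0 degenerate rank, a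
deinduction lemma, a split-prime Serre weight, a K3 anchor — none restated here; the `n = 0` trick does
not apply since `n = 4` is fixed); barrier catalogue `Literature/Barriers/Langlands/*` (Shimura-variety
realisation, non-regular weight, twisted-endoscopy, solvable image: none bites a Galois-free argument
over the auxiliary field, as the route header argues and I concur).
-/

noncomputable section

set_option linter.dupNamespace false

namespace Summit.Langlands.Langlands.Cruxes.SelfTwistedIrreducible.Disproof

open scoped NumberField Polynomial Classical
open Filter Polynomial NumberField IsDedekindDomain Field
open Literature.NumberTheory.GaloisRepresentations Literature.NumberTheory.Automorphic
open Summit.Langlands.Langlands.Theses.ExteriorSquareAscent (SelfTwistedIrreducible)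

/-! ## § 0. The crux read back with named clauses (verbatim bodies; `crux_iff` is `Iff.rfl`) -/

section Clauses

variable {K : Type} [Field K] [NumberField K] {hcpt : isCompact_glFiniteIntegralLevel 4 K}

/-- HECKE-FIELD clause (verbatim), for an automorphic datum `π` on `GL₄(𝔸_K)` (cuspidal or not). -/
def HasHeckeField (π : AutomorphicRepData (AutomorphyDatum.gl 4 K hcpt)) : Prop :=
  ∃ E : Subfield ℂ, FiniteDimensional ℚ E ∧ ∀ᶠ v in cofinite, ∀ α : Multiset ℂ, π.HasSatakeParamAt v α → ∀ i ≤ 4, ((((Real.sqrt (v.residueCard : ℝ)) : ℝ) : ℂ) ^ (i * (4 - i))) * α.esymm i ∈ E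

/-- SELF-TWIST clause (verbatim) for a given quadratic `L/K`: sign `+1` iff some prime of `L` above `v`
has residue degree `1` (split or ramified), `-1` iff `v` is inert. -/
def IsQuadSelfTwisted (π : AutomorphicRepData (AutomorphyDatum.gl 4 K hcpt)) (L : Type) [Field L]
    [NumberField L] [Algebra K L] : Prop :=
  Module.finrank K L = 2 ∧ ∀ᶠ v : HeightOneSpectrum (𝓞 K) in cofinite, ∀ α : Multiset ℂ, π.HasSatakeParamAt v α → α.map (fun a => (if ∃ w : HeightOneSpectrum (𝓞 L), w.asIdeal.under (𝓞 K) = v.asIdeal ∧ w.asIdeal.inertiaDeg (𝓞 K) = 1 then (1 : ℂ) else -1) * a) = α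

/-- COMPATIBILITY clause (verbatim): a.e. `v`, `π` has a Satake parameter `α` at `v`, `ρ` is unramified
at `v` and every arithmetic Frobenius has char-poly `arithFrobPolyOfSatake ι q_v 4 α`. -/
def IsCompatibleWith (π : AutomorphicRepData (AutomorphyDatum.gl 4 K hcpt)) {ℓ : ℕ} [Fact ℓ.Prime]
    (ι : PadicAlgCl ℓ ≃+* ℂ) (ρ : FramedGaloisRep K (PadicAlgCl ℓ) 4) : Prop :=
  ∀ᶠ v : HeightOneSpectrum (𝓞 K) in cofinite, ∃ α : Multiset ℂ, π.HasSatakeParamAt v α ∧ ρ.IsUnramifiedAt v ∧ ρ.HasFrobCharpolyAt v (arithFrobPolyOfSatake ι v.residueCard 4 α)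

end Clauses

/-- Read-back of the crux with named clauses — definitional (`Iff.rfl`), so the tree statement is exactly
"cuspidal + C-algebraic + Hecke field + quadratically self-twisted ⇒ every semisimple compatible `ρ` is
irreducible". [folklore] -/
theorem crux_iff : SelfTwistedIrreducible ↔
    ∀ (K : Type) [Field K] [NumberField K] (hcpt : isCompact_glFiniteIntegralLevel 4 K)
      (π : CuspidalAutomorphicRepData 4 K hcpt), π.1.IsCAlgebraic → HasHeckeField π.1 →
        (∃ (L' : Type) (_ : Field L') (_ : NumberField L') (_ : Algebra K L'), IsQuadSelfTwisted π.1 L') →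
          ∀ (ℓ : ℕ) [Fact ℓ.Prime] (ι : PadicAlgCl ℓ ≃+* ℂ) (ρ : FramedGaloisRep K (PadicAlgCl ℓ) 4),
            ρ.toGaloisRep.IsSemisimple → IsCompatibleWith π.1 ι ρ → ρ.toGaloisRep.IsIrreducible :=
  Iff.rfl

/-! ## § 1. Load-bearing analysis — the hypothesis-dropped variants (paper verdicts in the docstrings)

None of these can be decided in Lean today, for the single structural reason (F2): every variant still
quantifies over an automorphic datum with Satake parameters at cofinitely many places, and no such datum
on `GL₄` satisfying the self-twist clause is constructible in the tree (§ 2). The paper verdict is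
recorded per variant; "witness" always means a printed object, not a Lean term. -/

/-- VARIANT `WithoutCuspidal`: `π` ranges over ALL automorphic representation data of `GL₄(𝔸_K)`.
PAPER VERDICT: FALSE — cuspidality is load-bearing. Witness: `K = ℚ`, `L' = ℚ(i)`, the isobaric
(Eisenstein, induced from the Borel) representation `π₀ = ‖·‖^{1/2} ⊞ ε‖·‖^{1/2} ⊞ ‖·‖^{1/2} ⊞ ε‖·‖^{1/2}`
(`ε = ε_{ℚ(i)/ℚ}`): C-algebraic (archimedean exponents `(1/2, 1/2) ∈ (3/2 + ℤ)²`), Hecke field `ℚ`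
(`q^{3/2} e₁ = q(2 + 2ε(q))`, …), self-twisted (`t_v = q^{-1/2}{1, ε, 1, ε} = -t_v` at inert `v`),
and `ρ₀ = χ_cyc⁻¹ ⊗ (1 ⊕ ε ⊕ 1 ⊕ ε)` (`χ_cyc(Frob_p) = p`, arithmetic) is semisimple, compatible
(`arithFrobPolyOfSatake` has roots `(q^{3/2} · q^{-1/2} · {1, ε, 1, ε})⁻¹ = q⁻¹{1, ε, 1, ε}`) and
REDUCIBLE. A second, subtler witness family is shape (B) with `f ≅ f^γ`: an Artin representation
`V ⊕ V ⊗ ε` of `Gal(M/ℚ) ≅ S₃ × C₂` (`V` = standard of `S₃`, `ε` = sign of `C₂`, `L'` = fixed field of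
`S₃`), `V|_{Γ_L'} = W` irreducible, `ρ|_{Γ_L'} = W ⊕ W`, automorphic side `π(V)‖·‖^{1/2} ⊞ π(V)ε‖·‖^{1/2}`
(weight-one theta series) — isobaric, NOT cuspidal, precisely because here `f = BC(π(V)) ≅ f^γ`.
Neither witness is constructible in the tree (no Eisenstein series / weight-one forms as
`IsAutomorphicForm`; even `ρ₀` would need the named facts `isUnramifiedAt_cyclotomic`,
Frobenius-of-cyclotomic). -/
def WithoutCuspidal : Prop :=
  ∀ (K : Type) [Field K] [NumberField K] (hcpt : isCompact_glFiniteIntegralLevel 4 K)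
    (π : AutomorphicRepData (AutomorphyDatum.gl 4 K hcpt)), π.IsCAlgebraic → HasHeckeField π →
      (∃ (L' : Type) (_ : Field L') (_ : NumberField L') (_ : Algebra K L'), IsQuadSelfTwisted π L') →
        ∀ (ℓ : ℕ) [Fact ℓ.Prime] (ι : PadicAlgCl ℓ ≃+* ℂ) (ρ : FramedGaloisRep K (PadicAlgCl ℓ) 4),
          ρ.toGaloisRep.IsSemisimple → IsCompatibleWith π ι ρ → ρ.toGaloisRep.IsIrreducible

/-- `WithoutCuspidal` is a strengthening of the crux (specialise to cuspidal data). [folklore] -/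
theorem selfTwistedIrreducible_of_withoutCuspidal (h : WithoutCuspidal) : SelfTwistedIrreducible :=
  fun K _ _ hcpt π hC hE hST ℓ _ ι ρ hss hcomp => h K hcpt π.1 hC hE hST ℓ ι ρ hss hcomp

/-- VARIANT `WithoutSelfTwist`: drop the quadratic self-twist. This is "cuspidal C-algebraic with a Hecke
field ⇒ every semisimple compatible `ρ` irreducible" for ALL `π` on `GL₄` — it CONTAINS the route's
target `IrreducibleGL4` and the essentially-self-dual sector. PAPER VERDICT: believed TRUE (Ramakrishnan's
cuspidal ⇒ irreducible expectation; known for regular `π` over totally real `K` in the non-essentially-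
self-dual case, Shavali 2026 Thm A, and a.a. `ℓ` in polarised cases, Hui 2023), OPEN in general. So the
self-twist hypothesis is load-bearing for PROVABILITY (it is what makes the Galois-free argument run:
`ρ ≅ ρ ⊗ ε`, Clifford, shapes (A)/(B)), not for truth. No witness exists or is expected. -/
def WithoutSelfTwist : Prop :=
  ∀ (K : Type) [Field K] [NumberField K] (hcpt : isCompact_glFiniteIntegralLevel 4 K)
    (π : CuspidalAutomorphicRepData 4 K hcpt), π.1.IsCAlgebraic → HasHeckeField π.1 →
      ∀ (ℓ : ℕ) [Fact ℓ.Prime] (ι : PadicAlgCl ℓ ≃+* ℂ) (ρ : FramedGaloisRep K (PadicAlgCl ℓ) 4),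
        ρ.toGaloisRep.IsSemisimple → IsCompatibleWith π.1 ι ρ → ρ.toGaloisRep.IsIrreducible

/-- `WithoutSelfTwist` is a strengthening of the crux. [folklore] -/
theorem selfTwistedIrreducible_of_withoutSelfTwist (h : WithoutSelfTwist) : SelfTwistedIrreducible :=
  fun K _ _ hcpt π hC hE _ ℓ _ ι ρ hss hcomp => h K hcpt π hC hE ℓ ι ρ hss hcomp

/-- VARIANT `WithoutHeckeField`: drop E-rationality. PAPER VERDICT: believed TRUE but NOT PROVABLE along
any filed line — E-rationality of `charpoly ρ(Frob_v)` is what feeds Böckle–Hui/Waldschmidt in shape (A)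
(the four `ℓ`-adic characters must come from algebraic Hecke characters before `GL₂ × GL₁` L-functions
can be written down) and what makes `det W` a Hecke character in det-pinning's shape (B). By the
Clozel/Buzzard–Gee conjecture (C-algebraic ⇒ C-arithmetic) the clause is automatic, and for REGULAR
C-algebraic `π` it is Clozel's theorem (Clozel 1990 Thm 3.13), so the variant is a theorem in the regular
case and conjecturally equivalent to the crux in general. Load-bearing for the proof, not for truth. -/
def WithoutHeckeField : Prop :=
  ∀ (K : Type) [Field K] [NumberField K] (hcpt : isCompact_glFiniteIntegralLevel 4 K)
    (π : CuspidalAutomorphicRepData 4 K hcpt), π.1.IsCAlgebraic →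
      (∃ (L' : Type) (_ : Field L') (_ : NumberField L') (_ : Algebra K L'), IsQuadSelfTwisted π.1 L') →
        ∀ (ℓ : ℕ) [Fact ℓ.Prime] (ι : PadicAlgCl ℓ ≃+* ℂ) (ρ : FramedGaloisRep K (PadicAlgCl ℓ) 4),
          ρ.toGaloisRep.IsSemisimple → IsCompatibleWith π.1 ι ρ → ρ.toGaloisRep.IsIrreducible

/-- `WithoutHeckeField` is a strengthening of the crux. [folklore] -/
theorem selfTwistedIrreducible_of_withoutHeckeField (h : WithoutHeckeField) : SelfTwistedIrreducible :=
  fun K _ _ hcpt π hC _ hST ℓ _ ι ρ hss hcomp => h K hcpt π hC hST ℓ ι ρ hss hcomp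

/-- VARIANT `WithoutCAlgebraic`: drop `IsCAlgebraic`, keep the (C-normalised) Hecke field. PAPER
VERDICT: expected PROVABLE by the picked det-pinning line, which never uses `IsCAlgebraic` (PICKED.md);
in birth's line it is used exactly once — to make the inducing Hecke character `λ` of a dihedral `f`
algebraic (Weil avatar) — and § 3 shows that birth's `1/9`-density step genuinely needs that dihedral
branch. So `IsCAlgebraic` is NOT load-bearing for the statement (information for the prover: a proof
on the picked line should go through with `_hC` unused; if the linter then flags it, that is expected). -/
def WithoutCAlgebraic : Prop :=
  ∀ (K : Type) [Field K] [NumberField K] (hcpt : isCompact_glFiniteIntegralLevel 4 K)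
    (π : CuspidalAutomorphicRepData 4 K hcpt), HasHeckeField π.1 →
      (∃ (L' : Type) (_ : Field L') (_ : NumberField L') (_ : Algebra K L'), IsQuadSelfTwisted π.1 L') →
        ∀ (ℓ : ℕ) [Fact ℓ.Prime] (ι : PadicAlgCl ℓ ≃+* ℂ) (ρ : FramedGaloisRep K (PadicAlgCl ℓ) 4),
          ρ.toGaloisRep.IsSemisimple → IsCompatibleWith π.1 ι ρ → ρ.toGaloisRep.IsIrreducible

/-- `WithoutCAlgebraic` is a strengthening of the crux. [folklore] -/
theorem selfTwistedIrreducible_of_withoutCAlgebraic (h : WithoutCAlgebraic) : SelfTwistedIrreducible :=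
  fun K _ _ hcpt π _ hE hST ℓ _ ι ρ hss hcomp => h K hcpt π hE hST ℓ ι ρ hss hcomp

/-- VARIANT `WithoutSemisimple`: drop `IsSemisimple`. PAPER VERDICT: EQUIVALENT to the crux — given a
compatible `ρ`, its semisimplification `ρ^{ss}` is continuous, unramified where `ρ` is, has the same
characteristic polynomials, hence is compatible; the crux makes `ρ^{ss}` irreducible, and a
representation with irreducible semisimplification has a single Jordan–Hölder factor, so `ρ = ρ^{ss}` is
irreducible. The hypothesis is logically REDUNDANT (harmless). The converse implication below is the
trivial one; the non-trivial `SelfTwistedIrreducible → WithoutSemisimple` needs a semisimplification API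
for `FramedGaloisRep` (Jordan–Hölder + continuity of the graded pieces), not attempted here. -/
def WithoutSemisimple : Prop :=
  ∀ (K : Type) [Field K] [NumberField K] (hcpt : isCompact_glFiniteIntegralLevel 4 K)
    (π : CuspidalAutomorphicRepData 4 K hcpt), π.1.IsCAlgebraic → HasHeckeField π.1 →
      (∃ (L' : Type) (_ : Field L') (_ : NumberField L') (_ : Algebra K L'), IsQuadSelfTwisted π.1 L') →
        ∀ (ℓ : ℕ) [Fact ℓ.Prime] (ι : PadicAlgCl ℓ ≃+* ℂ) (ρ : FramedGaloisRep K (PadicAlgCl ℓ) 4),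
          IsCompatibleWith π.1 ι ρ → ρ.toGaloisRep.IsIrreducible

/-- `WithoutSemisimple` is (trivially) a strengthening of the crux. [folklore] -/
theorem selfTwistedIrreducible_of_withoutSemisimple (h : WithoutSemisimple) : SelfTwistedIrreducible :=
  fun K _ _ hcpt π hC hE hST ℓ _ ι ρ _ hcomp => h K hcpt π hC hE hST ℓ ι ρ hcomp

/-- VARIANT `WithoutCompatibility`: drop the Satake–Frobenius clause. PAPER VERDICT: FALSE as soon as ONE
`π` satisfying the automorphic hypotheses exists (take `ρ = 1^{⊕4}`, semisimple and reducible) — and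
such `π` exist in print (e.g. `K = ℚ`, `L' = ℚ(√5)`, `π = AI_{L'/ℚ}(g)` for a Hilbert newform `g` of
weight `(2, 4)` over `ℚ(√5)` not Galois-conjugate-invariant: cuspidal, regular C-algebraic, Hecke field,
self-twisted; VETTING.md). Still NOT refutable in Lean: the `∀ π` prefix ranges over a type the tree
cannot populate at `n = 4` (F2). Compatibility is of course load-bearing. -/
def WithoutCompatibility : Prop :=
  ∀ (K : Type) [Field K] [NumberField K] (hcpt : isCompact_glFiniteIntegralLevel 4 K)
    (π : CuspidalAutomorphicRepData 4 K hcpt), π.1.IsCAlgebraic → HasHeckeField π.1 →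
      (∃ (L' : Type) (_ : Field L') (_ : NumberField L') (_ : Algebra K L'), IsQuadSelfTwisted π.1 L') →
        ∀ (ℓ : ℕ) [Fact ℓ.Prime] (ρ : FramedGaloisRep K (PadicAlgCl ℓ) 4),
          ρ.toGaloisRep.IsSemisimple → ρ.toGaloisRep.IsIrreducible

/-- `WithoutCompatibility` is a strengthening of the crux. [folklore] -/
theorem selfTwistedIrreducible_of_withoutCompatibility (h : WithoutCompatibility) :
    SelfTwistedIrreducible :=
  fun K _ _ hcpt π hC hE hST ℓ _ _ ρ hss _ => h K hcpt π hC hE hST ℓ ρ hss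

/-! ## § 2. Why no in-tree automorphic witness can bite: the self-twist clause excludes abelian `π`

The only automorphic forms on `GL_n(𝔸_K)`, `n ≥ 1`, that the tree can currently exhibit are functions of
`det` (`affLogDet`: `χ ∘ det`, `log |det|`). A one-dimensional `χ ∘ det` has Satake parameter
`χ(ϖ_v) · {q^{-3/2}, q^{-1/2}, q^{1/2}, q^{3/2}}` at an unramified `v`. The two lemmas below show that the
crux's self-twist clause at an INERT place (`sign = -1`) forces the Satake multiset to be traceless, which
such a geometric progression with `c ≠ 0` never is. So even a hypothetical junk `CuspidalAutomorphicRepData`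
built from the `affLogDet` family (there is none at `n = 4`: constants fail the cusp condition) could not
serve as a witness against this crux or any § 1 variant. -/

/-- At a place with no degree-one prime above it (inert in `L`), the self-twist clause literally reads
`α.map (fun a => -1 * a) = α`. [folklore] -/
theorem selfTwist_clause_at_inert {K : Type} [Field K] [NumberField K] {L : Type} [Field L]
    [NumberField L] [Algebra K L] {v : HeightOneSpectrum (𝓞 K)} {α : Multiset ℂ}
    (hv : ¬ ∃ w : HeightOneSpectrum (𝓞 L), w.asIdeal.under (𝓞 K) = v.asIdeal ∧
      w.asIdeal.inertiaDeg (𝓞 K) = 1)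
    (h : α.map (fun a => (if ∃ w : HeightOneSpectrum (𝓞 L), w.asIdeal.under (𝓞 K) = v.asIdeal ∧
      w.asIdeal.inertiaDeg (𝓞 K) = 1 then (1 : ℂ) else -1) * a) = α) :
    α.map (fun a => (-1 : ℂ) * a) = α := by
  simpa [if_neg hv] using h

/-- A negation-stable complex multiset is traceless. [folklore] -/
theorem sum_eq_zero_of_neg_stable {α : Multiset ℂ} (h : α.map (fun a => (-1 : ℂ) * a) = α) :
    α.sum = 0 := by
  have h1 : (α.map (fun a => (-1 : ℂ) * a)).sum = (-1) * α.sum := by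
    rw [Multiset.sum_map_mul_left, Multiset.map_id']
  rw [h] at h1
  linear_combination (1 / 2 : ℂ) * h1

/-- **Rank-one Satake data are never self-twisted.** For `c ≠ 0` and `s > 0` (think `s = √q_v`,
`c = χ(ϖ_v)`), the Satake multiset `c · {s⁻³, s⁻¹, s, s³}` of the one-dimensional representation
`χ ∘ det` of `GL₄` is NOT stable under `a ↦ -a`: its trace is `c (s⁻³ + s⁻¹ + s + s³) ≠ 0`. Consequence
(F2): the abelian automorphic forms constructible in the tree cannot witness `¬ crux`. [folklore] -/
theorem rankOne_satake_not_selfTwisted (c : ℂ) (hc : c ≠ 0) (s : ℝ) (hs : 0 < s) :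
    ({c * ((s : ℂ)⁻¹) ^ 3, c * (s : ℂ)⁻¹, c * (s : ℂ), c * (s : ℂ) ^ 3} : Multiset ℂ).map
        (fun a => (-1 : ℂ) * a) ≠
      ({c * ((s : ℂ)⁻¹) ^ 3, c * (s : ℂ)⁻¹, c * (s : ℂ), c * (s : ℂ) ^ 3} : Multiset ℂ) := by
  intro h
  have h0 := sum_eq_zero_of_neg_stable h
  have hsum : ({c * ((s : ℂ)⁻¹) ^ 3, c * (s : ℂ)⁻¹, c * (s : ℂ), c * (s : ℂ) ^ 3} : Multiset ℂ).sum
      = c * (((s⁻¹ ^ 3 + s⁻¹ + s + s ^ 3 : ℝ)) : ℂ) := by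
    simp only [Multiset.insert_eq_cons, Multiset.sum_cons, Multiset.sum_singleton]
    push_cast
    ring
  rw [hsum] at h0
  have hr : (0 : ℝ) < s⁻¹ ^ 3 + s⁻¹ + s + s ^ 3 := by positivity
  have hr' : (((s⁻¹ ^ 3 + s⁻¹ + s + s ^ 3 : ℝ)) : ℂ) ≠ 0 := by exact_mod_cast hr.ne'
  exact mul_ne_zero hc hr' h0

/-! ## § 3. Natural strengthenings refuted by small models (kernel-checked, `decide`)

The route's printed proof line for shape (B) (Theses docstring; birth `stub_noDoubledShape`) bounds the
upper Dirichlet density of the scalar-Satake set `S = {w : t_{f,w} = {x, x}}` by `1/9` through the simple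
pole of `L(s, Ad f × Ad f)` — valid only for NON-dihedral `f` (`Ad f` cuspidal, Gelbart–Jacquet). The
natural strengthening "`δ̄(S) ≤ 1/9` (or even `< 1/8`) for EVERY cuspidal `f` on `GL₂`" is FALSE: by
Chebotarev, for the weight-one form attached to an irreducible 2-dimensional Artin representation `W` of
`Gal(M/L) ≅ D₄` the density of `S` is the proportion of `g` with `W(g)` scalar, which is `2/8 = 1/4`.
The finite shadow is checked below on the faithful integral 2-dimensional representation of the dihedral
group of order 8 (`DihedralGroup 4`): a homomorphism (`d4Rep_one`, `d4Rep_mul`), faithful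
(`d4Rep_injective`) with non-commuting image (`d4Rep_noncomm`, so irreducible over any algebraically
closed field: a 2-dimensional representation with non-abelian image has no stable line), whose scalar
locus `{g : W(g) = ±1}` (the only scalar matrices in the image) has EXACTLY 2 of 8 elements. Moral for
provers: the `1/9`-method needs its dihedral case split, hence `IsCAlgebraic` (Weil avatar of `λ`);
det-pinning does not (floor `1/2` vs cap `1/4`, both insensitive to dihedrality). Sharpness of
Ramakrishnan's `1/8` (classical, not re-checked here): in `Q₈ × C₂` the irreducible `ρ ⊗ 1` and
`ρ ⊗ sgn` (`ρ` the 2-dimensional representation of `Q₈`) have equal characters exactly off the `2`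
elements `{±1} × {t}`, i.e. they agree on `14/16 = 7/8` of the group and are not isomorphic. -/

/-- The faithful 2-dimensional integral representation of the dihedral group of order `8`:
`r ↦ R = (0 -1; 1 0)` (rotation by `π/2`), `s ↦ S = (1 0; 0 -1)`, `sr^j ↦ S R^j`. [folklore] -/
def d4Rep : DihedralGroup 4 → Matrix (Fin 2) (Fin 2) ℤ
  | DihedralGroup.r i =>
      match i.val with
      | 0 => 1
      | 1 => !![0, -1; 1, 0]
      | 2 => !![-1, 0; 0, -1]
      | _ => !![0, 1; -1, 0]
  | DihedralGroup.sr i =>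
      match i.val with
      | 0 => !![1, 0; 0, -1]
      | 1 => !![0, -1; -1, 0]
      | 2 => !![-1, 0; 0, 1]
      | _ => !![0, 1; 1, 0]

/-- `d4Rep` sends `1` to `1`. [folklore] -/
theorem d4Rep_one : d4Rep 1 = 1 := by decide

/-- `d4Rep` is multiplicative (all `64` products, by `decide`). [folklore] -/
theorem d4Rep_mul : ∀ a b : DihedralGroup 4, d4Rep (a * b) = d4Rep a * d4Rep b := by decide

/-- `d4Rep` is faithful. [folklore] -/
theorem d4Rep_injective : Function.Injective d4Rep := by decide

/-- The image of `d4Rep` is non-abelian (so the representation is irreducible over `ℂ`/`ℚ̄_ℓ`). [folklore] -/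
theorem d4Rep_noncomm :
    d4Rep (DihedralGroup.r 1) * d4Rep (DihedralGroup.sr 0) ≠
      d4Rep (DihedralGroup.sr 0) * d4Rep (DihedralGroup.r 1) := by decide

/-- **Scalar locus of proportion `1/4`.** Exactly `2` of the `8` elements act by a scalar (`±1`):
refutes "scalar-Satake density `≤ 1/9`" (and "`< 1/8`") for dihedral forms. [folklore] -/
theorem d4Rep_scalar_card :
    (Finset.univ.filter (fun g : DihedralGroup 4 => d4Rep g = 1 ∨ d4Rep g = -1)).card = 2 := by decide

/-- The group has order `8`, so the scalar proportion is `2/8 = 1/4 > 1/8 > 1/9`. [folklore] -/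
theorem d4_card : Fintype.card (DihedralGroup 4) = 8 := by decide

/-! ## § 4. Targets (lead's stuck stubs) — none registered this cycle

Payload `targets = []`, `stuck_stubs = []`. The lead picked line `Sketch` (idea det-pinning) at
2026-08-17T11:42Z; its stubs are not yet on the item. Pre-emptive adversarial pass on det-pinning's four
soft spots (all CLOSE on paper; recorded so the lead can cite them):
1. `ν = 1` on good pairs needs the EXACT dictionary `det W(Frob_w) = (q_w^{3/2})^{-2}·(x y)^{-1}` ↔
   `ω_f(ϖ_w)` including the `‖·‖³` shift and the arithmetic inversion of `arithFrobPolyOfSatake`; a slip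
   here makes `ν` a non-trivial power of the norm and the floor argument void — bookkeeping, not a gap.
2. `|ν| = 1`: `ν` algebraic Hecke, `= 1` at one good place of norm `> 1` ⇒ weight `0` ⇒ unitary; if the
   good set is finite the bad set has density `1` and the cap `1/4` already contradicts. Closed.
3. Cap `1/4` with NO Ramanujan input: `Σ_w |a_f(w)|² q_w^{-σ} ≤ log L^T(σ, f × f̄) + O(1)` because the
   omitted prime-power terms `|tr t_{f,w}^k|²/k` are `≥ 0`; and on a bad place `t_{f,w} = {x, x}` with
   `|x|² = |ω_f(ϖ_w)| = 1` after twisting `π` (hence `f`) to unitary central character (twisting is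
   harmless: bad/good sets and `f ≅ f^γ` are twist-invariant). Closed.
4. `det W` E-rational at inert `w` too: `charpoly ρ(Frob_v) = (X² - x²)(X² - y²) ∈ E[X]` gives
   `det W(Frob_w) = det W(Frob_v²) = (xy)² ∈ E`. At split `w`: monic square root of a monic square in
   `E[X]` lies in `E[X]`. Closed. (Only a.e. E-rationality is needed by the tree's rank-one Böckle–Hui.)
No `stub_false` candidate. -/

/-! ## § 5. Near-misses (paper; nothing sorried)

* The isobaric family of § 1 (`WithoutCuspidal`) and the Artin `S₃ × C₂` family `V ⊕ V ⊗ ε` are the two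
  honest near-counterexamples: they satisfy every clause except cuspidality (the second is shape (B) on
  the nose, with `AI(f)` non-cuspidal because `f ≅ f^γ`). They show WHERE cuspidality enters each shape:
  (A) through `GL₂ × GL₁` entireness, (B) through `f ≇ f^γ`.
* Mixed-signature `L'` (the case the crux exists for) changes nothing in either argument: no object is
  ever constructed over `L'`; all inputs (AC base change/induction, JS, Hecke `L(1, ν) ≠ 0`, RS pole,
  Waldschmidt/BH rank one) hold over arbitrary number fields.
* A genuine counterexample = a cuspidal `f` on `GL₂(𝔸_{L'})`, `f ≇ f^γ`, whose Satake data pair up as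
  `t_{f,w} ⊔ t_{f,γw} = {x, x, y, y}` against an `ℓ`-adic `W` extending to `Γ_K` — it would contradict
  GL₂ reciprocity for `f` (F3). Not searched numerically: no finite computation bears on it. -/

end Summit.Langlands.Langlands.Cruxes.SelfTwistedIrreducible.Disproof
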